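import Literature.MathematicalPhysics.QuantumFieldTheory.Balaban1983to89.B6Hprime2101TorusAlgebra

/-!
# `Balaban1983to89.B6DeltaPrime2109Torus` — T. Bałaban, *Propagators and renormalization transformations for lattice gauge
# theories. II*, Commun. Math. Phys. **96** (1984) 223–250 [Balaban1984PropagatorsII], (2.109) p.242: the two-sided bound
# `c₀‖Δ₀ω‖² ≤ ⟨ω, Δ′_jω⟩ ≤ c₁‖Δ₀ω‖² ≤ γ₁‖ω‖²` AS AN OPERATOR INEQUALITY for the typed torus `Δ′_j`

statement-level skeleton of published theorems with citation tags; proofs where landed; nothing here is a claim about the Yang–Mills mass gap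

PDF held: `paper:balaban1984-cmp96-propagators-rt-ii` (journal page = PDF page + 222); p. 242 [PDF 20] read.

CITATION HEADER (lean-in-tree rule).  WHAT IS REPRODUCED: lit-balaban SKELETON row **B6.Eq2.108** ((2.108)–(2.109) p. 242),
verbatim: *"In momentum representation on the unit lattice the operator Δ′_j is represented as the multiplication operator by the
function Δ′_j(p′) = Δ₀²(p′)(Σ_l|u_j(p′+l)|²Δ₀²(p′)/Δ²(p′+l))⁻¹. (2.108) It is easy to see that Δ′_j(p′) is an analytic function
of p′ and … hence Δ′_j(y − y′) decays exponentially with a decay rate depending on d only, and we have the inequalities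
c₀‖Δ₀ω‖² ≤ ⟨ω, Δ′_jω⟩ ≤ c₁‖Δ₀ω‖² ≤ γ₁‖ω‖² (2.109) for arbitrary ω, where the constants depend on d only."*  State of the
tree: (2.109) is PROVED AT SYMBOL LEVEL — `B6Hprime2101.bound_2109`: `c₀(d)·Δ₀(s)² ≤ Δ′(s) ≤ c₁(d)·Δ₀(s)² ≤ γ₁(d)` for every real
momentum `|s_μ| ≤ π` (Δ₀(s) = the unit-lattice Laplace symbol `B4Strip.Delta1r 0 s`, Δ′ = `dPr`), with explicit d-only constants
`c0_2109`, `c1_2109`, `gamma1_2109`; and Δ′_j is a TYPED OPERATOR on the unit torus `T = Π_μ ℤ/M_μ`: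
`B6Hprime2101TorusAlgebra.dPOp n M` (r03 g6 p254233, momentum multiplier (2.108) `dft_dPOp`).  THIS FILE proves (2.109) AS
PRINTED — an inequality between quadratic forms *"for arbitrary ω"* — for that typed operator, by Plancherel on the finite
torus: `c₀(d)·‖Δ₀ω‖² ≤ ⟨ω, Δ′_jω⟩ ≤ c₁(d)·‖Δ₀ω‖² ≤ γ₁(d)·‖ω‖²` for every `ω : T → ℂ`, every averaging factor `n = L^j ≥ 1`, every
torus, with Δ₀ = the unit-torus Laplace operator `B5Action121.LapS M 1`.  Unit `lit-balaban-r03` (B6 reader/owner, gen 6; own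
lineage `B6Hprime2101TorusAlgebra`), PHASE 2 (G.2(b) knitting: symbol level → operator level), HOME `run/shared/lean/pub/lit-balaban/`,
2026-08-21.  IMPORTS `…B6Hprime2101TorusAlgebra` (hence `B6Hprime2101`, `B5Momentum130/133`, `B5LaplaceInverse`,
`B5Prop11Plancherel`) — BY NAME; no new definition, no new named fact (theorems only).

DICTIONARY.  `⟨ω, Aω⟩ = star ω ⬝ᵥ (A *ᵥ ω)` (the unit-lattice pairing (2.69) on one level is the plain sum); `‖v‖² = star v ⬝ᵥ v`;
`ω̂ = dft M *ᵥ ω` (unitary DFT of `B5Prop11Plancherel`); `‖Δ₀ω‖² = ‖LapS M 1 *ᵥ ω‖²` (Δ₀ = unit-lattice Laplacian, so that Δ₀² is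
the momentum factor `Δ₀²(p′)` of (2.108): `lsym_one_eq`).

## Content (sorry-free; `[cite: …]` tags are TEXT LOCATIONS; the mathematics is `[folklore]` Plancherel bookkeeping)

* §1 `dot_eq_dot_dft` (Plancherel `⟨v, w⟩ = ⟨v̂, ŵ⟩`), `ssym_one_eq`/`norm_ssym_one_sq`/`lsym_one_eq` (the unit-torus Laplace symbol
  at the dual momentum `q` IS `Δ₀(p′) = Σ_μ (2 − 2cos p′_μ)` at `p′ = sOf M q`).
* §2 `form_dPOp`, `norm_LapS_sq`, `norm_sq_eq` — the three quadratic forms of (2.109) as momentum sums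
  `Σ_q Δ′(p′)|ω̂(q)|²`, `Σ_q Δ₀(p′)²|ω̂(q)|²`, `Σ_q |ω̂(q)|²`.
* §3 **`ineq2109_lower`, `ineq2109_upper`, `ineq2109_top`, `ineq2109`** — (2.109) for the typed operator, all ω.

## Honest scope

(i) TORUS MODEL (finite periodic unit lattice), complex ω (the paper's are real; the statement specialises); `U = 1`.
(ii) (2.110) (the refinement on `Q′₁ω = 0` with γ₀ = γ₀(d, L)) is NOT treated here.  (iii) Value = kernel certificate of
bookkeeping for a located, asserted display of [Balaban1984PropagatorsII]; NOT summit progress, NOT continuum, NOT Clay.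
-/

open scoped BigOperators Matrix ComplexConjugate Real
open Finset Complex

namespace Literature.MathematicalPhysics.QuantumFieldTheory.Balaban1983to89.B6DeltaPrime2109Torus

open Literature.MathematicalPhysics.QuantumFieldTheory.Balaban1983to89.B4Strip (ofRealVec S1r S1r_eq Delta1r Delta1r_nonneg)
open Literature.MathematicalPhysics.QuantumFieldTheory.Balaban1983to89.B5Prop11Plancherel (Tor dft sOf abs_sOf_le)
open Literature.MathematicalPhysics.QuantumFieldTheory.Balaban1983to89.B5Action121 (LapS)
open Literature.MathematicalPhysics.QuantumFieldTheory.Balaban1983to89.B5LaplaceInverse (ssym lsym dft_conjTranspose_mul)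
open Literature.MathematicalPhysics.QuantumFieldTheory.Balaban1983to89.B5Momentum130 (dft_LapS_apply)
open Literature.MathematicalPhysics.QuantumFieldTheory.Balaban1983to89.B5Momentum133 (lsym_eq_sum_norm_sq)
open Literature.MathematicalPhysics.QuantumFieldTheory.Balaban1983to89.B6Hprime2101 (dP dPr dP_ofReal c0_2109 c1_2109
  gamma1_2109 bound_2109)
open Literature.MathematicalPhysics.QuantumFieldTheory.Balaban1983to89.B6Hprime2101TorusAlgebra (dPOp dft_dPOp)

noncomputable section

variable {d : ℕ} (M : Fin d → ℕ) [hM : ∀ μ, NeZero (M μ)]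

/-! ## §1. Plancherel on the torus and the symbol of the unit Laplacian -/

/-- **Plancherel**: `⟨v, w⟩ = ⟨v̂, ŵ⟩` for the unitary DFT of the torus `Π_μ ℤ/M_μ`. [cite: Balaban1984PropagatorsII, (2.108) p.242 «In momentum representation on the unit lattice»] [folklore] -/
theorem dot_eq_dot_dft (v w : Tor M → ℂ) : star v ⬝ᵥ w = star (dft M *ᵥ v) ⬝ᵥ (dft M *ᵥ w) := by
  rw [Matrix.star_mulVec, ← Matrix.dotProduct_mulVec, Matrix.mulVec_mulVec, dft_conjTranspose_mul, Matrix.one_mulVec]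

/-- the forward-difference symbol of the UNIT torus at the dual momentum `q`: `∂_ν(p′) = e^{ip′_ν} − 1`, `p′ = sOf M q`. [cite: Balaban1984PropagatorsI, (1.31) p.23] [folklore] -/
theorem ssym_one_eq (ν : Fin d) (q : Tor M) :
    ssym M 1 ν q = Complex.exp (I * ((sOf M q ν : ℝ) : ℂ)) - 1 := by
  have h : (ZMod.stdAddChar (N := M ν)) (q ν) = Complex.exp (I * ((sOf M q ν : ℝ) : ℂ)) := by
    conv_lhs => rw [← ZMod.coe_valMinAbs (q ν)]
    rw [ZMod.stdAddChar_coe]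
    congr 1
    unfold sOf
    push_cast
    ring
  simp only [ssym, one_mul, h]

/-- `|∂_ν(p′)|² = 2 − 2cos p′_ν` on the unit torus. [cite: Balaban1984PropagatorsI, (1.31) p.23] [folklore] -/
theorem norm_ssym_one_sq (ν : Fin d) (q : Tor M) : ‖ssym M 1 ν q‖ ^ 2 = S1r (sOf M q ν) := by
  rw [ssym_one_eq, Complex.norm_exp_I_mul_ofReal_sub_one, S1r_eq, Real.norm_eq_abs, sq_abs]
  ring

/-- **the unit-torus Laplace symbol is `Δ₀(p′) = Σ_μ (2 − 2cos p′_μ)`** (`B4Strip.Delta1r 0`) at `p′ = sOf M q` — so `Δ₀²(p′)` of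
(2.108) is the symbol of `(LapS M 1)²`. [cite: Balaban1984PropagatorsII, (2.108) p.242] [folklore] -/
theorem lsym_one_eq (q : Tor M) : lsym M 1 q = ((Delta1r 0 (sOf M q) : ℝ) : ℂ) := by
  rw [lsym_eq_sum_norm_sq]
  congr 1
  unfold Delta1r
  rw [add_zero]
  exact Finset.sum_congr rfl fun ν _ => norm_ssym_one_sq M ν q

/-! ## §2. The three quadratic forms of (2.109) as momentum sums -/

/-- `‖ω‖² = Σ_q |ω̂(q)|²` (Plancherel, the right-most quantity of (2.109)). [cite: Balaban1984PropagatorsII, (2.109) p.242] [folklore] -/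
theorem norm_sq_eq (ω : Tor M → ℂ) :
    star ω ⬝ᵥ ω = ((∑ q, ‖(dft M *ᵥ ω) q‖ ^ 2 : ℝ) : ℂ) := by
  rw [dot_eq_dot_dft, dotProduct]
  push_cast
  exact Finset.sum_congr rfl fun q _ => by rw [Pi.star_apply, Complex.star_def, Complex.conj_mul']

/-- **`⟨ω, Δ′_jω⟩ = Σ_q Δ′_j(p′)|ω̂(q)|²`** for the typed `Δ′_j = dPOp n M` (momentum multiplier (2.108), `dft_dPOp`).
[cite: Balaban1984PropagatorsII, (2.108)–(2.109) p.242] [folklore] -/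
theorem form_dPOp (n : ℕ) [NeZero n] (ω : Tor M → ℂ) :
    star ω ⬝ᵥ (dPOp n M *ᵥ ω) = ((∑ q, dPr n (sOf M q) * ‖(dft M *ᵥ ω) q‖ ^ 2 : ℝ) : ℂ) := by
  have h : dft M *ᵥ (dPOp n M *ᵥ ω) = fun q => dP n (ofRealVec (sOf M q)) * (dft M *ᵥ ω) q :=
    funext fun q => dft_dPOp n M ω q
  rw [dot_eq_dot_dft, h, dotProduct]
  push_cast
  refine Finset.sum_congr rfl fun q _ => ?_
  rw [Pi.star_apply, Complex.star_def, dP_ofReal, ← Complex.conj_mul']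
  ring

/-- **`‖Δ₀ω‖² = Σ_q Δ₀(p′)²|ω̂(q)|²`** for the unit-torus Laplacian `Δ₀ = LapS M 1`. [cite: Balaban1984PropagatorsII, (2.109) p.242] [folklore] -/
theorem norm_LapS_sq (ω : Tor M → ℂ) :
    star (LapS M 1 *ᵥ ω) ⬝ᵥ (LapS M 1 *ᵥ ω) = ((∑ q, Delta1r 0 (sOf M q) ^ 2 * ‖(dft M *ᵥ ω) q‖ ^ 2 : ℝ) : ℂ) := by
  have h : dft M *ᵥ (LapS M 1 *ᵥ ω) = fun q => lsym M 1 q * (dft M *ᵥ ω) q :=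
    funext fun q => dft_LapS_apply M 1 ω q
  rw [dot_eq_dot_dft, h, dotProduct]
  push_cast
  refine Finset.sum_congr rfl fun q _ => ?_
  rw [Pi.star_apply, Complex.star_def, lsym_one_eq, map_mul, Complex.conj_ofReal, ← Complex.conj_mul']
  ring

/-! ## §3. (2.109) for the typed operator: `c₀‖Δ₀ω‖² ≤ ⟨ω, Δ′_jω⟩ ≤ c₁‖Δ₀ω‖² ≤ γ₁‖ω‖²` for every `ω` -/

/-- **(2.109), FIRST INEQUALITY, for the typed `Δ′_j`**: `c₀(d)‖Δ₀ω‖² ≤ ⟨ω, Δ′_jω⟩` for every `ω : T → ℂ`, every `n ≥ 1`, every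
torus (termwise from `B6Hprime2101.bound_2109` at the Brillouin-zone momenta `sOf M q`). [cite: Balaban1984PropagatorsII, (2.109) p.242] -/
theorem ineq2109_lower (n : ℕ) [NeZero n] (ω : Tor M → ℂ) :
    c0_2109 d * (star (LapS M 1 *ᵥ ω) ⬝ᵥ (LapS M 1 *ᵥ ω)).re ≤ (star ω ⬝ᵥ (dPOp n M *ᵥ ω)).re := by
  rw [norm_LapS_sq, form_dPOp, Complex.ofReal_re, Complex.ofReal_re, Finset.mul_sum]
  refine Finset.sum_le_sum fun q _ => ?_
  have h := (bound_2109 n (sOf M q) (abs_sOf_le M q)).1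
  have hw : 0 ≤ ‖(dft M *ᵥ ω) q‖ ^ 2 := sq_nonneg _
  calc c0_2109 d * (Delta1r 0 (sOf M q) ^ 2 * ‖(dft M *ᵥ ω) q‖ ^ 2)
      = (c0_2109 d * Delta1r 0 (sOf M q) ^ 2) * ‖(dft M *ᵥ ω) q‖ ^ 2 := by ring
    _ ≤ dPr n (sOf M q) * ‖(dft M *ᵥ ω) q‖ ^ 2 := mul_le_mul_of_nonneg_right h hw

/-- **(2.109), SECOND INEQUALITY, for the typed `Δ′_j`**: `⟨ω, Δ′_jω⟩ ≤ c₁(d)‖Δ₀ω‖²`. [cite: Balaban1984PropagatorsII, (2.109) p.242] -/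
theorem ineq2109_upper (n : ℕ) [NeZero n] (ω : Tor M → ℂ) :
    (star ω ⬝ᵥ (dPOp n M *ᵥ ω)).re ≤ c1_2109 d * (star (LapS M 1 *ᵥ ω) ⬝ᵥ (LapS M 1 *ᵥ ω)).re := by
  rw [norm_LapS_sq, form_dPOp, Complex.ofReal_re, Complex.ofReal_re, Finset.mul_sum]
  refine Finset.sum_le_sum fun q _ => ?_
  have h := (bound_2109 n (sOf M q) (abs_sOf_le M q)).2.1
  have hw : 0 ≤ ‖(dft M *ᵥ ω) q‖ ^ 2 := sq_nonneg _
  calc dPr n (sOf M q) * ‖(dft M *ᵥ ω) q‖ ^ 2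
      ≤ (c1_2109 d * Delta1r 0 (sOf M q) ^ 2) * ‖(dft M *ᵥ ω) q‖ ^ 2 := mul_le_mul_of_nonneg_right h hw
    _ = c1_2109 d * (Delta1r 0 (sOf M q) ^ 2 * ‖(dft M *ᵥ ω) q‖ ^ 2) := by ring

/-- **(2.109), THIRD INEQUALITY**: `c₁(d)‖Δ₀ω‖² ≤ γ₁(d)‖ω‖²` (the unit Laplace symbol is at most `4d`). [cite: Balaban1984PropagatorsII, (2.109) p.242] -/
theorem ineq2109_top (ω : Tor M → ℂ) :
    c1_2109 d * (star (LapS M 1 *ᵥ ω) ⬝ᵥ (LapS M 1 *ᵥ ω)).re ≤ gamma1_2109 d * (star ω ⬝ᵥ ω).re := by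
  rw [norm_LapS_sq, norm_sq_eq, Complex.ofReal_re, Complex.ofReal_re, Finset.mul_sum, Finset.mul_sum]
  refine Finset.sum_le_sum fun q _ => ?_
  have h := (bound_2109 1 (sOf M q) (abs_sOf_le M q)).2.2
  have hw : 0 ≤ ‖(dft M *ᵥ ω) q‖ ^ 2 := sq_nonneg _
  calc c1_2109 d * (Delta1r 0 (sOf M q) ^ 2 * ‖(dft M *ᵥ ω) q‖ ^ 2)
      = (c1_2109 d * Delta1r 0 (sOf M q) ^ 2) * ‖(dft M *ᵥ ω) q‖ ^ 2 := by ring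
    _ ≤ gamma1_2109 d * ‖(dft M *ᵥ ω) q‖ ^ 2 := mul_le_mul_of_nonneg_right h hw

/-- **(2.109) AS PRINTED, for the typed torus `Δ′_j` and ARBITRARY `ω`**: `c₀‖Δ₀ω‖² ≤ ⟨ω, Δ′_jω⟩ ≤ c₁‖Δ₀ω‖² ≤ γ₁‖ω‖²` with the
d-only constants `c₀(d)`, `c₁(d)`, `γ₁(d)` of `B6Hprime2101` — *"for arbitrary ω, where the constants depend on d only"*.
[cite: Balaban1984PropagatorsII, (2.109) p.242] -/
theorem ineq2109 (n : ℕ) [NeZero n] (ω : Tor M → ℂ) :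
    c0_2109 d * (star (LapS M 1 *ᵥ ω) ⬝ᵥ (LapS M 1 *ᵥ ω)).re ≤ (star ω ⬝ᵥ (dPOp n M *ᵥ ω)).re ∧
      (star ω ⬝ᵥ (dPOp n M *ᵥ ω)).re ≤ c1_2109 d * (star (LapS M 1 *ᵥ ω) ⬝ᵥ (LapS M 1 *ᵥ ω)).re ∧
      c1_2109 d * (star (LapS M 1 *ᵥ ω) ⬝ᵥ (LapS M 1 *ᵥ ω)).re ≤ gamma1_2109 d * (star ω ⬝ᵥ ω).re :=
  ⟨ineq2109_lower M n ω, ineq2109_upper M n ω, ineq2109_top M ω⟩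

/-- the quadratic form of the typed `Δ′_j` is REAL and NON-NEGATIVE (it is `Σ_q Δ′(p′)|ω̂(q)|²` with `Δ′ ≥ c₀Δ₀² ≥ 0`).
[cite: Balaban1984PropagatorsII, (2.109) p.242] [folklore] -/
theorem form_dPOp_nonneg (n : ℕ) [NeZero n] (ω : Tor M → ℂ) :
    0 ≤ (star ω ⬝ᵥ (dPOp n M *ᵥ ω)).re ∧ (star ω ⬝ᵥ (dPOp n M *ᵥ ω)).im = 0 := by
  refine ⟨le_trans ?_ (ineq2109_lower M n ω), by rw [form_dPOp, Complex.ofReal_im]⟩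
  rw [norm_LapS_sq, Complex.ofReal_re]
  exact mul_nonneg (B6Hprime2101.c0_2109_pos d).le
    (Finset.sum_nonneg fun q _ => mul_nonneg (sq_nonneg _) (sq_nonneg _))

end

end Literature.MathematicalPhysics.QuantumFieldTheory.Balaban1983to89.B6DeltaPrime2109Torus
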